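import Literature.MathematicalPhysics.QuantumFieldTheory.Balaban1983to89.B3Eq15MixedPartials
import Literature.MathematicalPhysics.QuantumFieldTheory.Balaban1983to89.B1Eq362TaylorRemainder
import Literature.Analysis.Calculus.TaylorSegmentWithin

/-!
# `Balaban1983to89.B3Eq15TaylorRemainder` — T. Bałaban, *(Higgs)₂,₃ quantum fields in a finite volume. III.
Renormalization*, Commun. Math. Phys. **88** (1983) 411–445 [Balaban1983Higgs3], (1.5) p. 412 [PDF 2]:
**the perturbative sum (1.5) IS the truncated Taylor expansion of the typed `E_k` in the two expansion parameters,
with an explicit Lagrange remainder.**  For the typed `E_k(e′, λ′, Ω, A^{(k)}, φ)` of (1.4)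
(`B3Eq14AuxFunction.Data14.auxE`), jointly `C^∞` on the slab `ℝ × [0, δ]` (`B3Eq15JointSmooth`), and every order `n̄`:
* at every `(e′, λ′)` with `λ′ ∈ [0, δ]` there is `θ ∈ (0, 1)` with
  `E_k(e′, λ′) = Σ_{0≤α+β≤n̄} (α!β!)⁻¹ e′^α λ′^β ∂^α_{e′}∂^β_{λ′,+}E_k(0, 0)
              + ((n̄+1)!)⁻¹ D^{n̄+1}_{ℝ×[0,δ]}E_k(θe′, θλ′)((e′,λ′), …, (e′,λ′))`
  — the polynomial being EXACTLY r12's one-sided perturbative sum `B1Sect3Statements.pertSum362R` of (I.3.36)/(I.3.62)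
  evaluated at the generating function `E_k` (`auxE_eq_pertSum362R_add_remainder`);
* at the physical point `(e′, λ′) = (1, 1)` (`δ ≥ 1`): `E_k(1, 1) = E_k(0, 0) + 𝒫^{(k)} + R_{n̄}`,
  `𝒫^{(k)} = B3Eq15OneSidedInteraction.interaction15R` the repaired (1.5) and
  `R_{n̄} = ((n̄+1)!)⁻¹ D^{n̄+1}_{ℝ×[0,δ]}E_k(θ, θ)((1,1)^{n̄+1})` (`auxE_one_one_eq_interaction15R_add_remainder`) — the
  print's reading of (1.5)/(I.3.62) (part I, p. 624 [PDF 22], after (I.3.62): *"Because we take here an expansion until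
  the order n̄ only, so in (3.61) we can take a whole function E_k instead of its expansion until the order n̄"* …
  *"instead of the Taylor expansion of the function E_k in the exponent we have the function E_k(…) itself"*
  [Balaban1982Higgs1]) made a theorem about the typed objects.

statement-level skeleton of published theorems with citation tags; proofs where landed; nothing here is a claim about
the Yang–Mills mass gap

THE ARGUMENT (ours; calculus).  Taylor's formula with Lagrange remainder along the segment from `(0, 0)` to
`(e′, λ′)` WITHIN the convex slab (`Literature.Analysis.Calculus.taylor_lagrange_segment_within`, Coleman Thm. 5.3):
`E_k(e′,λ′) = Σ_{i≤n̄} D^i E_k(0,0)((e′,λ′)^i)/i! + D^{n̄+1}E_k(θ·(e′,λ′))((e′,λ′)^{n̄+1})/(n̄+1)!`; the diagonal values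
of the SYMMETRIC (Schwarz within the slab, `B3Eq15MixedPartials.iteratedFDerivWithin_auxE_comp_perm`) multilinear
maps `D^i E_k(0,0)` on `(e′,λ′) = e′(1,0) + λ′(0,1)` expand binomially
(`Literature.Analysis.Calculus.map_const_add_smul_eq_sum_choose_of_symmetric`, Coleman App. Ch. 5) into the entries
`D^i E_k(0,0)((1,0)^α,(0,1)^{i−α})`, which are the iterated one-sided partials `∂^α_{e′}∂^{i−α}_{λ′,+}E_k(0,0)` of
(1.5) (`B3Eq15MixedPartials.iteratedDeriv_slice_auxE_eq_iteratedFDerivWithin`); re-indexing `(i, α) ↦ (α, β = i−α)`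
gives `pertSum362R`, and `interaction15R = pertSum362R(E_k)(1,1) − E_k(0,0)`
(`B3Eq15OneSidedInteraction.interaction15R_eq_pertSum362R_sub`).

WHAT IS PROVED (theorems only; no definition, no `Prop` fact; axioms standard).  Hypotheses (H-joint) of
`B3Eq15JointSmooth`/`B3Eq15MixedPartials`: `μ₀² > 0`, `a > 0`, `L > 1`, `1 ≤ k ≤ K`, `L^kε ≠ 0`, `λ(L^kε) ≥ 0`,
`m² > 0`, `δ > 0`, `m² + δm²(e′, λ′, x) > 0` on `ℝ × [0, δ] × Ω₁`, data `δm²`, `E₁` jointly `C^∞`: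
* **`auxE_taylor_diagonal`** (Taylor–Lagrange in diagonal form at every point of the slab);
* **`iteratedFDerivWithin_auxE_diagonal_eq_sum`** (`D^i E_k(0,0)((e′,λ′)^i) = Σ_α C(i,α) e′^α λ′^{i−α} ∂^α_{e′}∂^{i−α}_{λ′,+}E_k(0,0)`);
* **`auxE_eq_pertSum362R_add_remainder`**; **`auxE_one_one_eq_interaction15R_add_remainder`** (`δ ≥ 1`);
* (v1.2) **`exists_abs_auxE_sub_pertSum362R_le`**: for every `R` there is `C` with
  `|E_k(e′,λ′) − pertSum362R(E_k)(e′,λ′,n̄)| ≤ C ‖(e′,λ′)‖^{n̄+1}` for all `|e′| ≤ R`, `λ′ ∈ [0, δ]` — the sum IS the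
  expansion of `E_k` *"until the order n̄"* (I p. 624), uniformly on boxes (instance of the generic
  `B1Eq362TaylorRemainder.exists_abs_sub_pertSum362R_le`, continuity of `D^{n̄+1}E_k` on the compact box).
HONEST SCOPE: an IDENTITY with an explicit remainder for the typed `E_k`, and the qualitative `O(‖(e′,λ′)‖^{n̄+1})`
bound it implies by compactness — no EXPLICIT constant, nothing on the coefficients (the print's (1.7) and the
estimates of III §§2–3 are not touched), no statement about `k`-uniformity; the regularity is that of the SUPPLIED
data `Data14.dm2`, `Data14.E1`.
* v1.2 (typer g28): `import …B1Eq362TaylorRemainder` + `exists_abs_auxE_sub_pertSum362R_le` appended; v1.0/v1.1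
  declarations byte-identical.

PDF held: `paper:balaban1983-higgs-2-3-quantum-fields-finite-volume` (journal page = PDF page + 410); (1.5) p. 412
[PDF 2] read from the render `run/shared/lean/pub/pub-balaban/b2b-balaban-ref1/pages/` (paper III p002).

CITATION HEADER (lean-in-tree rule).  lit-balaban TYPED SKELETON (HOME `run/shared/lean/pub/lit-balaban/`), rows
**B3.Eq1.4** / **B3.Eq1.5** (owner r15; decls of record `B3Eq14AuxFunction.Data14.auxE`,
`B3Eq15OneSidedInteraction.interaction15R`), cross-reference **B1.Eq3.36**/(I.3.62) (r12's `pertSum362R`); unit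
`lit-balaban-typer` (literature-prover-lit-balaban-typer-g28-0).  Nothing of any other seat is touched; no row changes head.
PDF of part I held: `paper:balaban1982-cmp85-higgs23-i` (journal page = PDF page + 602; render
`run/shared/lean/pub/pub-balaban/b2b-balaban-ref1/pages/1982-cmp85-higgs23-I/…-p022-x2.png`).
-/

open _root_.MeasureTheory

namespace Literature.MathematicalPhysics.QuantumFieldTheory.Balaban1983to89.B3Eq15TaylorRemainder

open Literature.MathematicalPhysics.QuantumFieldTheory.Balaban1983to89.HiggsLattice
open Literature.MathematicalPhysics.QuantumFieldTheory.Balaban1983to89.B3Eq14AuxFunction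
open Literature.MathematicalPhysics.QuantumFieldTheory.Balaban1983to89.B3Eq15OneSidedInteraction
open Literature.MathematicalPhysics.QuantumFieldTheory.Balaban1983to89.B3Eq15JointSmooth
  (contDiffOn_auxE_joint_infty)
open Literature.MathematicalPhysics.QuantumFieldTheory.Balaban1983to89.B3Eq15MixedPartials
  (iteratedDeriv_slice_auxE_eq_iteratedFDerivWithin iteratedFDerivWithin_auxE_comp_perm)
open Literature.Analysis.Calculus
  (taylor_lagrange_segment_within map_const_add_smul_eq_sum_choose_of_symmetric)
open Set Filter Topology
open scoped BigOperators ContDiff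

noncomputable section

variable {P : HiggsLattice.Params} {N : ℕ} {k : ℕ} (D : Data14 P N k)

/-- **Re-indexing a double Taylor sum**: summing `F(α, i − α)` over `α ≤ i ≤ n` is summing `F(α, β)` over the
pairs with `α + β ≤ n` (both coordinates `≤ n`) — the index set of `B1Sect3Statements.pertSum362R`. [folklore] -/
private theorem sum_range_sum_range_eq_sum_filter_add_le {X : Type*} [AddCommMonoid X] (F : ℕ → ℕ → X) (n : ℕ) :
    ∑ i ∈ Finset.range (n + 1), ∑ α ∈ Finset.range (i + 1), F α (i - α)
      = ∑ ab ∈ (Finset.range (n + 1) ×ˢ Finset.range (n + 1)).filter (fun ab => ab.1 + ab.2 ≤ n),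
          F ab.1 ab.2 := by
  have hset : (Finset.range (n + 1) ×ˢ Finset.range (n + 1)).filter (fun ab : ℕ × ℕ => ab.1 + ab.2 ≤ n)
      = (Finset.range (n + 1)).biUnion (fun i => Finset.HasAntidiagonal.antidiagonal i) := by
    ext ⟨a, b⟩
    simp only [Finset.mem_filter, Finset.mem_product, Finset.mem_range, Finset.mem_biUnion,
      Finset.HasAntidiagonal.mem_antidiagonal]
    constructor
    · rintro ⟨-, h⟩; exact ⟨a + b, by omega, rfl⟩
    · rintro ⟨i, hi, h⟩; omega
  have hdisj : Set.PairwiseDisjoint (↑(Finset.range (n + 1)) : Set ℕ) (fun i => Finset.HasAntidiagonal.antidiagonal i) := by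
    intro i _ i' _ hne
    refine Finset.disjoint_left.2 fun p hp hp' => hne ?_
    rw [Finset.HasAntidiagonal.mem_antidiagonal] at hp hp'
    rw [← hp, ← hp']
  rw [hset, Finset.sum_biUnion hdisj]
  refine Finset.sum_congr rfl fun i _ => ?_
  exact (Finset.Nat.sum_antidiagonal_eq_sum_range_succ (fun a b => F a b) i).symm

/-- For `h : α + β = i` the block tuple `(u^α, v^{i−α})` on `Fin i` is the concatenation `(u^α, v^β)` on `Fin (α + β)`,
and the corresponding entries of `D^i_S Φ` and `D^{α+β}_S Φ` agree. [folklore] -/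
private theorem iteratedFDerivWithin_block_eq_append {X : Type*} [NormedAddCommGroup X] [NormedSpace ℝ X]
    (Φ : X → ℝ) (S : Set X) (p : X) (u v : X) {α β i : ℕ} (h : α + β = i) :
    iteratedFDerivWithin ℝ i Φ S p (fun j : Fin i => if (j : ℕ) < α then u else v)
      = iteratedFDerivWithin ℝ (α + β) Φ S p (Fin.append (fun _ : Fin α => u) (fun _ : Fin β => v)) := by
  subst h
  congr 1
  funext j
  refine Fin.addCases (fun l => ?_) (fun l => ?_) j
  · rw [Fin.append_left, if_pos (by rw [Fin.val_castAdd]; exact l.isLt)]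
  · rw [Fin.append_right, if_neg (by rw [Fin.val_natAdd]; omega)]

/-- **TAYLOR–LAGRANGE FOR `E_k` IN DIAGONAL FORM** at every point `(e′, λ′)` of the slab `ℝ × [0, δ]` (H-joint,
`δ > 0`, `C^∞` data; every `n̄`): there is `θ ∈ (0, 1)` with
`E_k(e′, λ′) = Σ_{i ≤ n̄} (i!)⁻¹ D^i_{ℝ×[0,δ]}E_k(0, 0)((e′,λ′), …, (e′,λ′))
             + ((n̄+1)!)⁻¹ D^{n̄+1}_{ℝ×[0,δ]}E_k(θe′, θλ′)((e′,λ′), …, (e′,λ′))`. [cite: Balaban1983Higgs3, (1.5) p.412] -/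
theorem auxE_taylor_diagonal (hmsq : 0 < D.msq) (ha : 0 < D.a) (hL : 1 < (P.L : ℝ)) (hk1 : 1 ≤ k) (hk : k ≤ P.K)
    (hℓ : D.ell ≠ 0) (hrun : 0 ≤ D.lamRun) (hm2 : 0 < D.m2) {δ : ℝ} (hδ : 0 < δ)
    (hmass : ∀ (e' s : ℝ), s ∈ Set.Icc (0 : ℝ) δ → ∀ x ∈ D.Ω₁, 0 < D.m2 + D.dm2 e' s x)
    (hdm2 : ∀ x ∈ D.Ω₁, ContDiff ℝ ∞ (fun p : ℝ × ℝ => D.dm2 p.1 p.2 x))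
    (hE1 : ContDiff ℝ ∞ (fun p : ℝ × ℝ => D.E1 p.1 p.2)) (Ak : HiggsLattice.VecField P 0)
    (φ : HiggsLattice.ScalarField P k N) (nbar : ℕ) {e' l' : ℝ} (hl' : l' ∈ Set.Icc (0 : ℝ) δ) :
    ∃ θ ∈ Set.Ioo (0 : ℝ) 1,
      D.auxE e' l' Ak φ
        = ∑ i ∈ Finset.range (nbar + 1),
            ((i.factorial : ℝ))⁻¹ * iteratedFDerivWithin ℝ i (fun p : ℝ × ℝ => D.auxE p.1 p.2 Ak φ)
              (Set.univ ×ˢ Set.Icc 0 δ) (0, 0) (fun _ => (e', l'))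
          + (((nbar + 1).factorial : ℝ))⁻¹ * iteratedFDerivWithin ℝ (nbar + 1) (fun p : ℝ × ℝ => D.auxE p.1 p.2 Ak φ)
              (Set.univ ×ˢ Set.Icc 0 δ) (θ * e', θ * l') (fun _ => (e', l')) := by
  have hE := (contDiffOn_auxE_joint_infty D hmsq ha hL hk1 hk hℓ hrun hm2 hmass hdm2 hE1 Ak φ).of_le
    (show (((nbar + 1 : ℕ) : ℕ∞) : WithTop ℕ∞) ≤ ((⊤ : ℕ∞) : WithTop ℕ∞) by exact_mod_cast le_top)
  have hS : UniqueDiffOn ℝ (Set.univ ×ˢ Set.Icc (0 : ℝ) δ : Set (ℝ × ℝ)) :=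
    uniqueDiffOn_univ.prod (uniqueDiffOn_Icc hδ)
  have hSc : Convex ℝ (Set.univ ×ˢ Set.Icc (0 : ℝ) δ : Set (ℝ × ℝ)) := convex_univ.prod (convex_Icc 0 δ)
  have h0 : ((0 : ℝ), (0 : ℝ)) ∈ (Set.univ ×ˢ Set.Icc (0 : ℝ) δ : Set (ℝ × ℝ)) :=
    ⟨Set.mem_univ _, ⟨le_rfl, hδ.le⟩⟩
  have hx : ((0 : ℝ), (0 : ℝ)) + (e', l') ∈ (Set.univ ×ˢ Set.Icc (0 : ℝ) δ : Set (ℝ × ℝ)) := by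
    rw [Prod.mk_add_mk, zero_add, zero_add]
    exact ⟨Set.mem_univ _, hl'⟩
  obtain ⟨θ, hθ, h⟩ := taylor_lagrange_segment_within hS hSc hE h0 hx
  refine ⟨θ, hθ, ?_⟩
  rw [Prod.mk_add_mk, zero_add, zero_add, Prod.smul_mk, smul_eq_mul, smul_eq_mul, Prod.mk_add_mk, zero_add,
    zero_add] at h
  exact h

/-- **THE DIAGONAL VALUES OF `D^i E_k(0, 0)` ARE THE WEIGHTED ITERATED ONE-SIDED PARTIALS OF (1.5)**:
`D^i_{ℝ×[0,δ]}E_k(0,0)((e′,λ′), …, (e′,λ′)) = Σ_{α=0}^{i} C(i,α) e′^α λ′^{i−α} · ∂^α_{e′}[∂^{i−α}_{λ′,[0,∞)}E_k(e′,·)(0)](0)`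
(binomial expansion of the symmetric `i`-linear map on `e′(1,0) + λ′(0,1)`; H-joint, `δ > 0`, `C^∞` data).
[cite: Balaban1983Higgs3, (1.5) p.412] -/
theorem iteratedFDerivWithin_auxE_diagonal_eq_sum (hmsq : 0 < D.msq) (ha : 0 < D.a) (hL : 1 < (P.L : ℝ))
    (hk1 : 1 ≤ k) (hk : k ≤ P.K) (hℓ : D.ell ≠ 0) (hrun : 0 ≤ D.lamRun) (hm2 : 0 < D.m2) {δ : ℝ} (hδ : 0 < δ)
    (hmass : ∀ (e' s : ℝ), s ∈ Set.Icc (0 : ℝ) δ → ∀ x ∈ D.Ω₁, 0 < D.m2 + D.dm2 e' s x)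
    (hdm2 : ∀ x ∈ D.Ω₁, ContDiff ℝ ∞ (fun p : ℝ × ℝ => D.dm2 p.1 p.2 x))
    (hE1 : ContDiff ℝ ∞ (fun p : ℝ × ℝ => D.E1 p.1 p.2)) (Ak : HiggsLattice.VecField P 0)
    (φ : HiggsLattice.ScalarField P k N) (i : ℕ) (e' l' : ℝ) :
    iteratedFDerivWithin ℝ i (fun p : ℝ × ℝ => D.auxE p.1 p.2 Ak φ) (Set.univ ×ˢ Set.Icc 0 δ) (0, 0)
        (fun _ => (e', l'))
      = ∑ α ∈ Finset.range (i + 1), ((i.choose α : ℝ) * e' ^ α * l' ^ (i - α))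
          * iteratedDeriv α (fun e => iteratedDerivWithin (i - α) (fun l => D.auxE e l Ak φ) (Set.Ici 0) 0) 0 := by
  have hsymm := iteratedFDerivWithin_auxE_comp_perm D hmsq ha hL hk1 hk hℓ hrun hm2 hδ hmass hdm2 hE1 Ak φ i 0
    (t := 0) ⟨le_rfl, hδ.le⟩
  have hpt : (fun _ : Fin i => ((e', l') : ℝ × ℝ)) = fun _ => e' • ((1 : ℝ), (0 : ℝ)) + l' • ((0 : ℝ), (1 : ℝ)) := by
    funext j
    rw [Prod.smul_mk, Prod.smul_mk, Prod.mk_add_mk, smul_eq_mul, smul_eq_mul, smul_eq_mul, smul_eq_mul, mul_one,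
      mul_zero, mul_zero, mul_one, add_zero, zero_add]
  rw [hpt, map_const_add_smul_eq_sum_choose_of_symmetric _ hsymm]
  refine Finset.sum_congr rfl fun α hα => ?_
  have hαi : α ≤ i := Nat.lt_succ_iff.1 (Finset.mem_range.1 hα)
  rw [smul_eq_mul, iteratedFDerivWithin_block_eq_append _ _ _ _ _ (Nat.add_sub_cancel' hαi),
    ← iteratedDeriv_slice_auxE_eq_iteratedFDerivWithin D hmsq ha hL hk1 hk hℓ hrun hm2 hδ hmass hdm2 hE1 Ak φ
      α (i - α) 0]

/-- **`E_k(e′, λ′) = [ONE-SIDED PERTURBATIVE SUM (I.3.62)/(1.5) OF `E_k` AT `(e′, λ′)`] + LAGRANGE REMAINDER**: for every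
`(e′, λ′) ∈ ℝ × [0, δ]` and every `n̄` there is `θ ∈ (0, 1)` with
`E_k(e′, λ′) = Σ_{0≤α+β≤n̄} (α!β!)⁻¹ e′^α λ′^β ∂^α_{e′}∂^β_{λ′,+}E_k(0, 0) + ((n̄+1)!)⁻¹ D^{n̄+1}_{ℝ×[0,δ]}E_k(θe′, θλ′)((e′,λ′)^{n̄+1})`,
the polynomial being r12's `B1Sect3Statements.pertSum362R` at the generating function `E_k` (H-joint, `δ > 0`,
`C^∞` data). [cite: Balaban1983Higgs3, (1.5) p.412] -/
theorem auxE_eq_pertSum362R_add_remainder (hmsq : 0 < D.msq) (ha : 0 < D.a) (hL : 1 < (P.L : ℝ)) (hk1 : 1 ≤ k)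
    (hk : k ≤ P.K) (hℓ : D.ell ≠ 0) (hrun : 0 ≤ D.lamRun) (hm2 : 0 < D.m2) {δ : ℝ} (hδ : 0 < δ)
    (hmass : ∀ (e' s : ℝ), s ∈ Set.Icc (0 : ℝ) δ → ∀ x ∈ D.Ω₁, 0 < D.m2 + D.dm2 e' s x)
    (hdm2 : ∀ x ∈ D.Ω₁, ContDiff ℝ ∞ (fun p : ℝ × ℝ => D.dm2 p.1 p.2 x))
    (hE1 : ContDiff ℝ ∞ (fun p : ℝ × ℝ => D.E1 p.1 p.2)) (Ak : HiggsLattice.VecField P 0)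
    (φ : HiggsLattice.ScalarField P k N) (nbar : ℕ) {e' l' : ℝ} (hl' : l' ∈ Set.Icc (0 : ℝ) δ) :
    ∃ θ ∈ Set.Ioo (0 : ℝ) 1,
      D.auxE e' l' Ak φ
        = B1Sect3Statements.pertSum362R (fun e l => D.auxE e l Ak φ) e' l' nbar
          + (((nbar + 1).factorial : ℝ))⁻¹ * iteratedFDerivWithin ℝ (nbar + 1) (fun p : ℝ × ℝ => D.auxE p.1 p.2 Ak φ)
              (Set.univ ×ˢ Set.Icc 0 δ) (θ * e', θ * l') (fun _ => (e', l')) := by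
  obtain ⟨θ, hθ, h⟩ := auxE_taylor_diagonal D hmsq ha hL hk1 hk hℓ hrun hm2 hδ hmass hdm2 hE1 Ak φ nbar hl'
  refine ⟨θ, hθ, ?_⟩
  rw [h]
  congr 1
  have hterm : ∀ i ∈ Finset.range (nbar + 1),
      ((i.factorial : ℝ))⁻¹ * iteratedFDerivWithin ℝ i (fun p : ℝ × ℝ => D.auxE p.1 p.2 Ak φ)
          (Set.univ ×ˢ Set.Icc 0 δ) (0, 0) (fun _ => (e', l'))
        = ∑ α ∈ Finset.range (i + 1),
            1 / ((α.factorial : ℝ) * ((i - α).factorial : ℝ)) * e' ^ α * l' ^ (i - α)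
              * iteratedDeriv α (fun e => iteratedDerivWithin (i - α) (fun l => D.auxE e l Ak φ) (Set.Ici 0) 0) 0 := by
    intro i _
    rw [iteratedFDerivWithin_auxE_diagonal_eq_sum D hmsq ha hL hk1 hk hℓ hrun hm2 hδ hmass hdm2 hE1 Ak φ i e' l',
      Finset.mul_sum]
    refine Finset.sum_congr rfl fun α hα => ?_
    have hαi : α ≤ i := Nat.lt_succ_iff.1 (Finset.mem_range.1 hα)
    have hfac : (i.factorial : ℝ) = (i.choose α : ℝ) * (α.factorial : ℝ) * ((i - α).factorial : ℝ) := by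
      rw [← Nat.choose_mul_factorial_mul_factorial hαi]
      push_cast
      ring
    have hα0 : (α.factorial : ℝ) ≠ 0 := by exact_mod_cast α.factorial_ne_zero
    have hβ0 : ((i - α).factorial : ℝ) ≠ 0 := by exact_mod_cast (i - α).factorial_ne_zero
    have hc0 : (i.choose α : ℝ) ≠ 0 := by exact_mod_cast (Nat.choose_pos hαi).ne'
    rw [hfac]
    field_simp
  rw [Finset.sum_congr rfl hterm, B1Sect3Statements.pertSum362R]
  exact sum_range_sum_range_eq_sum_filter_add_le
    (fun α β => 1 / ((α.factorial : ℝ) * (β.factorial : ℝ)) * e' ^ α * l' ^ β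
      * iteratedDeriv α (fun e => iteratedDerivWithin β (fun l => D.auxE e l Ak φ) (Set.Ici 0) 0) 0) nbar

/-- **(1.5) WITH ITS REMAINDER AT THE PHYSICAL POINT: `E_k(1, 1) = E_k(0, 0) + 𝒫^{(k)} + R_{n̄}`**, where
`𝒫^{(k)} = interaction15R` is the repaired perturbative sum (1.5) (the expansion *"until the order n̄"*, I p. 624) and
`R_{n̄} = ((n̄+1)!)⁻¹ D^{n̄+1}_{ℝ×[0,δ]}E_k(θ, θ)((1,1), …, (1,1))` for some `θ ∈ (0, 1)` (H-joint with `δ ≥ 1`, `C^∞`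
data; every `n̄`). [cite: Balaban1983Higgs3, (1.5) p.412] -/
theorem auxE_one_one_eq_interaction15R_add_remainder (hmsq : 0 < D.msq) (ha : 0 < D.a) (hL : 1 < (P.L : ℝ))
    (hk1 : 1 ≤ k) (hk : k ≤ P.K) (hℓ : D.ell ≠ 0) (hrun : 0 ≤ D.lamRun) (hm2 : 0 < D.m2) {δ : ℝ} (hδ : 1 ≤ δ)
    (hmass : ∀ (e' s : ℝ), s ∈ Set.Icc (0 : ℝ) δ → ∀ x ∈ D.Ω₁, 0 < D.m2 + D.dm2 e' s x)
    (hdm2 : ∀ x ∈ D.Ω₁, ContDiff ℝ ∞ (fun p : ℝ × ℝ => D.dm2 p.1 p.2 x))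
    (hE1 : ContDiff ℝ ∞ (fun p : ℝ × ℝ => D.E1 p.1 p.2)) (Ak : HiggsLattice.VecField P 0)
    (φ : HiggsLattice.ScalarField P k N) (nbar : ℕ) :
    ∃ θ ∈ Set.Ioo (0 : ℝ) 1,
      D.auxE 1 1 Ak φ
        = D.auxE 0 0 Ak φ + interaction15R D nbar Ak φ
          + (((nbar + 1).factorial : ℝ))⁻¹ * iteratedFDerivWithin ℝ (nbar + 1) (fun p : ℝ × ℝ => D.auxE p.1 p.2 Ak φ)
              (Set.univ ×ˢ Set.Icc 0 δ) (θ, θ) (fun _ => ((1 : ℝ), (1 : ℝ))) := by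
  have hδ0 : 0 < δ := lt_of_lt_of_le zero_lt_one hδ
  obtain ⟨θ, hθ, h⟩ := auxE_eq_pertSum362R_add_remainder D hmsq ha hL hk1 hk hℓ hrun hm2 hδ0 hmass hdm2 hE1 Ak φ
    nbar (e' := 1) (l' := 1) ⟨zero_le_one, hδ⟩
  refine ⟨θ, hθ, ?_⟩
  rw [h, interaction15R_eq_pertSum362R_sub, mul_one]
  ring

/-- **`E_k` MINUS ITS ORDER-`n̄` PERTURBATIVE SUM IS `O(‖(e′, λ′)‖^{n̄+1})`, UNIFORMLY ON BOXES** (v1.2): under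
(H-joint), for every order `n̄` and every `R` there is `C` with
`|E_k(e′, λ′) − pertSum362R(E_k)(e′, λ′, n̄)| ≤ C ‖(e′, λ′)‖^{n̄+1}` for all `|e′| ≤ R`, `λ′ ∈ [0, δ]`
(`‖(e′, λ′)‖ = max(|e′|, |λ′|)`) — the typed form of *"an expansion until the order n̄"* of `E_k` (part I p. 624, after
(I.3.62)); instance of `B1Eq362TaylorRemainder.exists_abs_sub_pertSum362R_le` at the jointly `C^∞` typed `E_k`
(`B3Eq15JointSmooth.contDiffOn_auxE_joint_infty`). [cite: Balaban1983Higgs3, (1.5) p.412] -/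
theorem exists_abs_auxE_sub_pertSum362R_le (hmsq : 0 < D.msq) (ha : 0 < D.a) (hL : 1 < (P.L : ℝ)) (hk1 : 1 ≤ k)
    (hk : k ≤ P.K) (hℓ : D.ell ≠ 0) (hrun : 0 ≤ D.lamRun) (hm2 : 0 < D.m2) {δ : ℝ} (hδ : 0 < δ)
    (hmass : ∀ (e' s : ℝ), s ∈ Set.Icc (0 : ℝ) δ → ∀ x ∈ D.Ω₁, 0 < D.m2 + D.dm2 e' s x)
    (hdm2 : ∀ x ∈ D.Ω₁, ContDiff ℝ ∞ (fun p : ℝ × ℝ => D.dm2 p.1 p.2 x))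
    (hE1 : ContDiff ℝ ∞ (fun p : ℝ × ℝ => D.E1 p.1 p.2)) (Ak : HiggsLattice.VecField P 0)
    (φ : HiggsLattice.ScalarField P k N) (nbar : ℕ) (R : ℝ) :
    ∃ C : ℝ, ∀ e' ∈ Set.Icc (-R) R, ∀ l' ∈ Set.Icc (0 : ℝ) δ,
      |D.auxE e' l' Ak φ - B1Sect3Statements.pertSum362R (fun e l => D.auxE e l Ak φ) e' l' nbar|
        ≤ C * ‖((e', l') : ℝ × ℝ)‖ ^ (nbar + 1) :=
  B1Eq362TaylorRemainder.exists_abs_sub_pertSum362R_le (E := fun e l => D.auxE e l Ak φ) hδ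
    ((contDiffOn_auxE_joint_infty D hmsq ha hL hk1 hk hℓ hrun hm2 hmass hdm2 hE1 Ak φ).of_le
      (show (((nbar + 1 : ℕ) : ℕ∞) : WithTop ℕ∞) ≤ ((⊤ : ℕ∞) : WithTop ℕ∞) by exact_mod_cast le_top)) R

end

end Literature.MathematicalPhysics.QuantumFieldTheory.Balaban1983to89.B3Eq15TaylorRemainder
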